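import Summits.MatrixMultiplication.MatrixMultiplication.Statement
import Summits.MatrixMultiplication.MatrixMultiplication.Theses.ShapeSubmodularity
import Summits.MatrixMultiplication.MatrixMultiplication.Theorems.ShapeSubmodularityShapeSubmodularCoreReduction

/-!
# Strategist r1 sketch — crux `ShapeSubmodular` (stmt-MatrixMultiplication-15622)

(rev 2, 14:4xZ: self-contained — imports the route file for the crux DEF and `…CoreReduction` for
`ShapeSubmodular_of_omega_eq_two` only; does NOT depend on the route's deciding theorem `closes`, which was removed when the
route was CLOSED `superseded:route-MatrixMultiplication-CubicExchangeSplit` at 2026-08-17T14:08:24Z.)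

The best TYPED conjunct split of the crux I could produce (census `## Decomposition`):

* `StaircaseCellTwo`  (S₂) — the single staircase cell `k = 2` of SUBMOD, p = (2,1,1), q = (1,2,1):
  `ω(2,2,1) + ω(1,1,1) ≤ ω(2,1,1) + ω(1,2,1) = 2·ω(1,1,2)`; literally the crux body at these six naturals.
* `AmortisedAtTwo`    (X₁) — `e(2) = 0`, i.e. `ω(1,1,2) = 3`: PerfectAmortisation's body frozen at `k = 2`.

Assembly (proved below, sorry-free): `S₂ → X₁ → ω(ℂ) = 2 → ShapeSubmodular` — the route's `closes`
specialised to `k = 2`, then the landed `ShapeSubmodular_of_omega_eq_two`.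
Neither piece is known to give the summit alone (S₂ ⟹ ω ≤ 2ω(1,1,2) − 4 ≤ 2.5008 with the VXXZ2024 row;
X₁ ⟹ ω ≤ 9/4 by symmetrisation), but NEITHER HAS A PLAN: S₂ is exactly the cell where the kernel-checked
shape models `h_t` fail (`exists_darkPoint_shapeModel`, p158410), and X₁ lies inside the CW_q-method
barrier `CLLZ2025_omegaTwo_barrier_CW_holds` (every CW_q bound on ω(2) is ≥ 3.0626 > 3).  Not filed.
-/

set_option linter.dupNamespace false

namespace Summit.MatrixMultiplication.MatrixMultiplication.Cruxes.ShapeSubmodular.StrategistR1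

open Summit.MatrixMultiplication.MatrixMultiplication.Theses.ShapeSubmodularity
open Literature.Computability.AlgebraicComplexity
open Filter

/-- S₂: the staircase cell `k = 2` of SUBMOD (the crux `ShapeSubmodular` at a=2,b=1,c=1,a'=1,b'=2,c'=1). -/
def StaircaseCellTwo : Prop :=
  ∀ β β' : ℝ,
    (fun n : ℕ => (tensorRank (matMulTensor ℂ (n ^ 2) (n ^ 1) (n ^ 1)) : ℝ)) =O[atTop] (fun n : ℕ => (n : ℝ) ^ β) →
    (fun n : ℕ => (tensorRank (matMulTensor ℂ (n ^ 1) (n ^ 2) (n ^ 1)) : ℝ)) =O[atTop] (fun n : ℕ => (n : ℝ) ^ β') →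
    ∀ ε : ℝ, 0 < ε → ∃ γ γ' : ℝ, γ + γ' ≤ β + β' + ε ∧
      (fun n : ℕ => (tensorRank (matMulTensor ℂ (n ^ max 2 1) (n ^ max 1 2) (n ^ max 1 1)) : ℝ)) =O[atTop]
        (fun n : ℕ => (n : ℝ) ^ γ) ∧
      (fun n : ℕ => (tensorRank (matMulTensor ℂ (n ^ min 2 1) (n ^ min 1 2) (n ^ min 1 1)) : ℝ)) =O[atTop]
        (fun n : ℕ => (n : ℝ) ^ γ')

/-- S₂ is an instance of the crux. -/
theorem staircaseCellTwo_of_ShapeSubmodular (h : ShapeSubmodular) : StaircaseCellTwo :=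
  h 2 1 1 1 2 1

/-- X₁ = `e(2) = 0`: `R⟨n,n,n²⟩ = O(n^{3+ε})` for every `ε > 0` (PerfectAmortisation's body at `k = 2`). -/
def AmortisedAtTwo : Prop :=
  ∀ ε : ℝ, 0 < ε →
    (fun n : ℕ => (tensorRank (matMulTensor ℂ n n (n ^ 2)) : ℝ)) =O[atTop]
      fun n : ℕ => (n : ℝ) ^ (((2 : ℕ) : ℝ) + 1 + ε)

/-- The assembly of the split, exponent form: `S₂ → X₁ → ω(ℂ) ≤ 2` (the route's `closes` frozen at `k = 2`). -/
theorem omega_le_two_of_split (hS : StaircaseCellTwo) (hE : AmortisedAtTwo) : omega ℂ ≤ 2 := by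
  have congr3 : ∀ {k k' m m' l l' : ℕ}, k = k' → m = m' → l = l' →
      tensorRank (matMulTensor ℂ k m l) = tensorRank (matMulTensor ℂ k' m' l') := by
    intro k k' m m' l l' hk hm hl
    subst hk; subst hm; subst hl; rfl
  -- flattening in exponent coordinates: an O(n^γ) bound on R⟨n^k, n^k, n^1⟩ forces 2k ≤ γ
  have flat : ∀ (k : ℕ) (γ : ℝ),
      (fun n : ℕ => (tensorRank (matMulTensor ℂ (n ^ k) (n ^ k) (n ^ 1)) : ℝ))
        =O[atTop] (fun n : ℕ => (n : ℝ) ^ γ) → 2 * (k : ℝ) ≤ γ := by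
    intro k γ hγ
    by_contra hlt
    rw [not_le] at hlt
    obtain ⟨C, hC⟩ := Asymptotics.isBigO_iff.1 hγ
    have hev : ∀ᶠ n : ℕ in atTop, (n : ℝ) ^ (2 * (k : ℝ) - γ) ≤ C := by
      filter_upwards [hC, eventually_gt_atTop 0] with n hn hn0
      have hn0' : (0 : ℝ) < n := Nat.cast_pos.2 hn0
      rw [Real.norm_of_nonneg (Nat.cast_nonneg _),
        Real.norm_of_nonneg (Real.rpow_nonneg (Nat.cast_nonneg _) _)] at hn
      have hflat : n ^ k * n ^ k ≤ tensorRank (matMulTensor ℂ (n ^ k) (n ^ k) (n ^ 1)) := by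
        haveI : NeZero (n ^ 1) := ⟨(pow_pos hn0 1).ne'⟩
        exact mul_le_tensorRank_matMulTensor_left ℂ (n ^ k) (n ^ k) (n ^ 1)
      have hpow : (n : ℝ) ^ (2 * (k : ℝ)) = ((n ^ k * n ^ k : ℕ) : ℝ) := by
        rw [show (2 * (k : ℝ)) = ((2 * k : ℕ) : ℝ) by push_cast; ring, Real.rpow_natCast]
        push_cast
        ring
      have hsq : (n : ℝ) ^ (2 * (k : ℝ)) ≤ C * (n : ℝ) ^ γ := by
        refine le_trans ?_ hn
        rw [hpow]
        exact_mod_cast hflat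
      rw [Real.rpow_sub hn0', div_le_iff₀ (Real.rpow_pos_of_pos hn0' _)]
      exact hsq
    have hlim : Tendsto (fun n : ℕ => (n : ℝ) ^ (2 * (k : ℝ) - γ)) atTop atTop :=
      (tendsto_rpow_atTop (by linarith)).comp tendsto_natCast_atTop_atTop
    obtain ⟨n, hn₁, hn₂⟩ := (hev.and (hlim.eventually_gt_atTop C)).exists
    exact absurd hn₁ (not_le.2 hn₂)
  refine le_of_forall_pos_lt_add fun ε hε => ?_
  have hO := hE (ε / 8) (by positivity)
  have hk : (1 : ℕ) ≤ 2 := by norm_num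
  have hk11 : (fun n : ℕ => (tensorRank (matMulTensor ℂ (n ^ 2) (n ^ 1) (n ^ 1)) : ℝ))
      =O[atTop] (fun n : ℕ => (n : ℝ) ^ (((2 : ℕ) : ℝ) + 1 + ε / 8)) := by
    have hfun : (fun n : ℕ => (tensorRank (matMulTensor ℂ (n ^ 2) (n ^ 1) (n ^ 1)) : ℝ)) =
        fun n : ℕ => (tensorRank (matMulTensor ℂ n n (n ^ 2)) : ℝ) := by
      funext n
      rw [congr3 rfl (pow_one n) (pow_one n), tensorRank_matMulTensor_rotate ℂ (n ^ 2) n n]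
    rw [hfun]
    exact hO
  have h1k1 : (fun n : ℕ => (tensorRank (matMulTensor ℂ (n ^ 1) (n ^ 2) (n ^ 1)) : ℝ))
      =O[atTop] (fun n : ℕ => (n : ℝ) ^ (((2 : ℕ) : ℝ) + 1 + ε / 8)) := by
    have hfun : (fun n : ℕ => (tensorRank (matMulTensor ℂ (n ^ 1) (n ^ 2) (n ^ 1)) : ℝ)) =
        fun n : ℕ => (tensorRank (matMulTensor ℂ n n (n ^ 2)) : ℝ) := by
      funext n
      rw [congr3 (pow_one n) rfl (pow_one n), tensorRank_matMulTensor_rotate ℂ n (n ^ 2) n,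
        tensorRank_matMulTensor_rotate ℂ (n ^ 2) n n]
    rw [hfun]
    exact hO
  obtain ⟨γ, γ', hsum, hjoin, hmeet⟩ := hS _ _ hk11 h1k1 (ε / 4) (by positivity)
  rw [max_eq_left hk, max_eq_right hk, max_self] at hjoin
  rw [min_eq_right hk, min_eq_left hk, min_self] at hmeet
  have hγ : 2 * ((2 : ℕ) : ℝ) ≤ γ := flat 2 γ hjoin
  have hγ' : omega ℂ ≤ γ' := by
    have hmem : γ' ∈ admissibleExponents ℂ := by
      have hfun : (fun n : ℕ => (tensorRank (matMulTensor ℂ n n n) : ℝ)) =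
          fun n : ℕ => (tensorRank (matMulTensor ℂ (n ^ 1) (n ^ 1) (n ^ 1)) : ℝ) := by
        funext n
        rw [congr3 (pow_one n) (pow_one n) (pow_one n)]
      show (fun n : ℕ => (tensorRank (matMulTensor ℂ n n n) : ℝ)) =O[atTop] fun n : ℕ => (n : ℝ) ^ γ'
      rw [hfun]
      exact hmeet
    exact csInf_le (admissibleExponents_bddBelow ℂ) hmem
  have h2 : ((2 : ℕ) : ℝ) = 2 := by norm_num
  linarith [h2]

/-- The assembly of the split at summit level: `S₂ → X₁ → MatrixMultiplication`. -/
theorem matrixMultiplication_of_split (hS : StaircaseCellTwo) (hE : AmortisedAtTwo) :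
    _root_.MatrixMultiplication :=
  (_root_.MatrixMultiplication_iff).2 (le_antisymm (omega_le_two_of_split hS hE) (omega_two_le ℂ))

/-- **Assembly of the split** `S₂ → X₁ → ShapeSubmodular` (through `ω = 2` and the landed necessity
direction `ShapeSubmodular_of_omega_eq_two`). -/
theorem ShapeSubmodular_of_split (hS : StaircaseCellTwo) (hE : AmortisedAtTwo) : ShapeSubmodular :=
  Theorems.ShapeSubmodular.ShapeSubmodular_of_omega_eq_two (omega_le_two_of_split hS hE |>.antisymm (omega_two_le ℂ))

#print axioms ShapeSubmodular_of_split

end Summit.MatrixMultiplication.MatrixMultiplication.Cruxes.ShapeSubmodular.StrategistR1
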